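import Literature.Computability.Cryptography.PeriodFindingAccuracy
import Literature.Computability.Complexity.CodeFPRat
import HarnessLib

/-!
# Reading the character off a unit of the shift experiment, in polynomial time

Topic `Computability/Cryptography`; the classical computation of `PeriodFinding.cEst`
(`PeriodFindingAccuracy.lean`: Kitaev's reconstruction of the character `c` from the read-out of one
unit — block counts, quadrant centres, the halving refinement `refined`, rounding `Q · φ̂`) as a
string function in the typed polynomial-time algebra `CodeFP` (`Complexity/CodeFP*.lean`), for the
classical post-processor of Hallgren's algorithm (Jozsa 2003, §10) and of any user of the shift
experiment. Kitaev 1995, §3 (proof of Thm. 1): the reconstruction "can be done in polynomial time".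
Theorem-and-definition file, no named facts.

* `γL Lv B bits` — the read-out of a unit presented as a bit list (test `(l, σ, i)` at position
  `i + B σ + 2B l`, the layout of `ShiftSamplingFamily.eK`); the list-level `cntL`, `levelL`, `βL`
  with `cntU_γL`, `levelEstU_γL`, `phaseEstU_γL`, and `refineAux_eq_foldl` (the refinement as a
  left fold);
* rational bricks `ratSub'`, `ratAbs'`, `ratFloor`, `ratRound`, `cdistC`,
  `halveTowardsC`; the dyadic invariant of the refinement (`IsDyadic`, `isDyadic_halveTowards`,
  `length_encodeRat_le_of_isDyadic`) bounding the accumulator;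
* **`codeFP_cEstL`**: `(Q, 1^{Lv}, 1^{B}, bits) ↦ cEst Q (γL Lv B bits)` is computed on codes in
  polynomial time.

## References

* A. Yu. Kitaev, arXiv:quant-ph/9511026 (1995), §3 (Lemma 10, Thm 1). [Kitaev1995]
* R. Jozsa, arXiv:quant-ph/0302134 (2003), §10. [Jozsa2003]
* S. Arora, B. Barak, *Computational Complexity*, CUP 2009, §1.3. [AroraBarak2009]
-/

noncomputable section

namespace Literature.Computability.Cryptography

namespace PeriodFinding

open _root_.Computability Complexity Complexity.CodeFP Complexity.Brick Kitaev1995 Finset Polynomial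
open Literature.Algebra.EuclideanLattices (encodeRat)

/-! ### The read-out of a unit as a bit list -/

variable {Lv B : ℕ}

/-- The position of test `(l, σ, i)` in the unit's bit list: `i + B σ + 2B l`. [folklore] -/
def posOf (B l : ℕ) (σ : Bool) (i : ℕ) : ℕ := i + B * σ.toNat + 2 * B * l

/-- **The read-out of a unit presented as a bit list.** [folklore] -/
def γL (Lv B : ℕ) (bits : List Bool) : TIdx Lv B → Bool := fun τ => bits.getD (posOf B τ.1 τ.2.1 τ.2.2) false

/-- The number of `1`s in block `(l, σ)`, list level. [cite: Kitaev1995, §3 (before Lemma 9)] -/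
def cntL (B : ℕ) (bits : List Bool) (l : ℕ) (σ : Bool) : ℕ :=
  ((List.range B).map fun i => (bits.getD (posOf B l σ i) false).toNat).sum

/-- An indicator is `Bool.toNat`. [folklore] -/
private theorem ite_eq_toNat' (b : Bool) : (if b = true then 1 else 0) = b.toNat := by cases b <;> rfl

/-- `cntU` of the list read-out is `cntL`. [folklore] -/
theorem cntU_γL (bits : List Bool) (l : Fin Lv) (σ : Bool) : cntU (γL Lv B bits) l σ = cntL B bits l σ := by
  classical
  unfold cntU cntL
  rw [tblock_eq_image, filter_image, card_image_of_injective _ (fun i j h => by simpa using h)]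
  rw [← List.sum_toFinset _ List.nodup_range, List.toFinset_range, ← Fin.sum_univ_eq_sum_range, card_eq_sum_ones, sum_filter]
  refine sum_congr rfl fun i _ => ?_
  exact ite_eq_toNat' _

/-- The quadrant centre of level `l`, list level. [cite: Kitaev1995, §3 Lemma 10] -/
def levelL (B : ℕ) (bits : List Bool) (l : ℕ) : ℚ :=
  quadrantCenter (decide (2 * cntL B bits l false ≤ B)) (decide (2 * cntL B bits l true ≤ B))

/-- `levelEstU` of the list read-out is `levelL`. [folklore] -/
theorem levelEstU_γL (bits : List Bool) (l : Fin Lv) : levelEstU (γL Lv B bits) l = levelL B bits l := by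
  unfold levelEstU levelL; rw [cntU_γL, cntU_γL]

/-- The level estimates as a total function of the level. [folklore] -/
def βL (Lv B : ℕ) (bits : List Bool) (l : ℕ) : ℚ := if l < Lv then levelL B bits l else 0

/-- `phaseEstU` of the list read-out is the refinement of `βL`. [folklore] -/
theorem phaseEstU_γL (bits : List Bool) : phaseEstU (γL Lv B bits) = refined (βL Lv B bits) Lv := by
  unfold phaseEstU βL
  congr 1
  funext l
  split_ifs with h
  · exact levelEstU_γL bits ⟨l, h⟩
  · rfl

/-- **The refinement as a left fold**: `refineAux β L d` folds `halveTowards · (β (L − 2 − i))` over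
`i < d` from `β (L − 1)`. [cite: Kitaev1995, §3 Lemma 10] -/
theorem refineAux_eq_foldl {𝕜 : Type*} [Field 𝕜] [LinearOrder 𝕜] [FloorRing 𝕜] (β : ℕ → 𝕜) (L : ℕ) :
    ∀ d, refineAux β L d = (List.range d).foldl (fun a i => halveTowards a (β (L - 1 - (i + 1)))) (β (L - 1))
  | 0 => rfl
  | d + 1 => by rw [refineAux, List.range_succ, List.foldl_append, List.foldl_cons, List.foldl_nil, refineAux_eq_foldl β L d]

/-- The guarded refinement step (idle beyond depth `Lv − 1`). [folklore] -/
def refStep (Lv B : ℕ) (bits : List Bool) (a : ℚ) (i : ℕ) : ℚ :=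
  if i + 1 < Lv then halveTowards a (βL Lv B bits (Lv - 1 - (i + 1))) else a

/-- The refinement as a fold of the guarded step over `range Lv`. [folklore] -/
theorem refined_eq_foldl_refStep (bits : List Bool) :
    refined (βL Lv B bits) Lv = (List.range Lv).foldl (refStep Lv B bits) (βL Lv B bits (Lv - 1)) := by
  rw [refined, refineAux_eq_foldl]
  rcases Nat.eq_zero_or_pos Lv with h0 | hpos
  · subst h0; rfl
  · conv_rhs => rw [show Lv = (Lv - 1) + 1 by omega, List.range_succ, List.foldl_append]
    simp only [List.foldl_cons, List.foldl_nil]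
    rw [refStep, if_neg (by omega)]
    rw [show Lv - 1 + 1 = Lv by omega]
    apply List.foldl_ext
    intro a i hi
    rw [List.mem_range] at hi
    rw [refStep, if_pos (by omega)]

/-- **The character read off a unit's bit list.** [cite: Kitaev1995, §3 Thm 1] -/
def cEstL (Q Lv B : ℕ) (bits : List Bool) : ℕ := cEst Q (γL Lv B bits)

/-- `cEstL` in closed form. [folklore] -/
theorem cEstL_eq (Q Lv B : ℕ) (bits : List Bool) : cEstL Q Lv B bits =
    ((round ((List.range Lv).foldl (refStep Lv B bits) (βL Lv B bits (Lv - 1)) * Q) : ℤ) % (Q : ℤ)).toNat := by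
  rw [cEstL, cEst, phaseEstU_γL, refined_eq_foldl_refStep]

/-! ### Rational bricks -/

/-- Subtraction of rationals. [folklore] -/
theorem ratSub' : CodeFP (pairE encodeRat encodeRat) encodeRat (fun p => p.1 - p.2) := by
  have h := (ratAdd.comp ((fst _ _).pair (ratMul.comp ((const _ (-1 : ℚ)).pair (snd _ _)))) :)
  exact h.congr fun p => by show p.1 + (-1) * p.2 = p.1 - p.2; ring

/-- Absolute value of a rational (`|q| = |num|/den`). [folklore] -/
theorem ratAbs' : CodeFP encodeRat encodeRat (fun q => |q|) := by
  have h := ratOfIntNat.comp ((intAbs.comp ratNumDen.fst').pair ratNumDen.snd')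
  refine h.congr fun q => ?_
  show ((|q.num| : ℤ) : ℚ) / (q.den : ℚ) = |q|
  rw [Int.cast_abs, ← Nat.abs_cast q.den, ← abs_div, Rat.num_div_den]

/-- Comparison of rationals (sign of the numerator of the difference; as `CodeFP.ratLe` of `RejectionSamplerArithFP.lean`, a private copy to keep the imports light). [folklore] -/
private theorem ratLe' : CodeFP (pairE encodeRat encodeRat) bitE (fun p => decide (p.1 ≤ p.2)) := by
  have hd : CodeFP (pairE encodeRat encodeRat) encodeRat (fun p => p.2 - p.1) := (ratSub'.comp ((snd _ _).pair (fst _ _)) :)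
  have hn : CodeFP (pairE encodeRat encodeRat) intE (fun p => (p.2 - p.1).num) := (ratNumDen.comp hd).fst'
  have h := intLe.comp ((const _ (0 : ℤ)).pair hn)
  refine h.congr fun p => ?_
  show decide ((0 : ℤ) ≤ (p.2 - p.1).num) = decide (p.1 ≤ p.2)
  have : ((0 : ℤ) ≤ (p.2 - p.1).num) ↔ (p.1 ≤ p.2) := by rw [Rat.num_nonneg, sub_nonneg]
  simp only [this]

/-- The floor of a rational (`num div den`). [folklore] -/
theorem ratFloor : CodeFP encodeRat intE (fun q => ⌊q⌋) := by
  have hfl : CodeFP encodeRat intE (fun q => q.num / (q.den : ℤ)) := (intEDiv.comp (ratNumDen.fst'.pair (intOfNat.comp ratNumDen.snd')) :)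
  exact hfl.congr fun q => by
    show q.num / (q.den : ℤ) = ⌊q⌋
    rw [← Rat.floor_intCast_div_natCast, Rat.num_div_den]

/-- Rounding of a rational (`⌊q + ½⌋`). [folklore] -/
theorem ratRound : CodeFP encodeRat intE (fun q => round q) := by
  have h := (ratFloor.comp (ratAdd.comp ((CodeFP.id encodeRat).pair (const _ (1 / 2 : ℚ)))) :)
  exact h.congr fun q => by
    show ⌊q + 1 / 2⌋ = round q
    rw [round_eq]

/-- An integer as a rational. [folklore] -/
theorem ratOfInt' : CodeFP intE encodeRat (fun z => (z : ℚ)) := by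
  have h := (ratOfIntNat.comp ((CodeFP.id intE).pair (const intE (1 : ℕ))) :)
  exact h.congr fun z => by simp

/-- A natural as a rational. [folklore] -/
theorem ratOfNat' : CodeFP natE encodeRat (fun n => (n : ℚ)) := by
  have h := (ratOfIntNat.comp (intOfNat.pair (const natE (1 : ℕ))) :)
  exact h.congr fun n => by simp

/-- The circular distance `cdist a b = |a − b − round (a − b)|` on codes. [cite: Kitaev1995, §3 Lemma 10] -/
theorem cdistC : CodeFP (pairE encodeRat encodeRat) encodeRat (fun p => cdist p.1 p.2) := by
  have hd : CodeFP (pairE encodeRat encodeRat) encodeRat (fun p => p.1 - p.2) := ratSub'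
  have hr : CodeFP (pairE encodeRat encodeRat) encodeRat (fun p => ((round (p.1 - p.2) : ℤ) : ℚ)) := (ratOfInt'.comp (ratRound.comp hd) :)
  have hfin := (ratAbs'.comp (ratSub'.comp (hd.pair hr)) :)
  exact hfin.congr fun p => by simp [cdist]

/-- Kitaev's halving step on codes. [cite: Kitaev1995, §3 Lemma 10] -/
theorem halveTowardsC : CodeFP (pairE encodeRat encodeRat) encodeRat (fun p => halveTowards p.1 p.2) := by
  have ha : CodeFP (pairE encodeRat encodeRat) encodeRat (fun p => p.1) := fst _ _
  have hb : CodeFP (pairE encodeRat encodeRat) encodeRat (fun p => p.2) := snd _ _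
  have h1' := (ratMul.comp (ha.pair (const _ (1 / 2 : ℚ))) :)
  have h1 : CodeFP (pairE encodeRat encodeRat) encodeRat (fun p => p.1 / 2) := h1'.congr fun p => by
    show p.1 * (1 / 2) = p.1 / 2; ring
  have h2' := (ratMul.comp ((ratAdd.comp (ha.pair (const _ (1 : ℚ)))).pair (const _ (1 / 2 : ℚ))) :)
  have h2 : CodeFP (pairE encodeRat encodeRat) encodeRat (fun p => (p.1 + 1) / 2) := h2'.congr fun p => by
    show (p.1 + 1) * (1 / 2) = (p.1 + 1) / 2; ring
  have hc1 : CodeFP (pairE encodeRat encodeRat) encodeRat (fun p => cdist (p.1 / 2) p.2) := (cdistC.comp (h1.pair hb) :)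
  have hc2 : CodeFP (pairE encodeRat encodeRat) encodeRat (fun p => cdist ((p.1 + 1) / 2) p.2) := (cdistC.comp (h2.pair hb) :)
  have h : CodeFP (pairE encodeRat encodeRat) encodeRat
      (fun p => if decide (cdist (p.1 / 2) p.2 ≤ cdist ((p.1 + 1) / 2) p.2) then p.1 / 2 else (p.1 + 1) / 2) :=
    (ratLe'.comp (hc1.pair hc2)).ite h1 h2
  exact h.congr fun p => by
    simp only [halveTowards]
    by_cases hc : cdist (p.1 / 2) p.2 ≤ cdist ((p.1 + 1) / 2) p.2
    · rw [if_pos hc, decide_eq_true hc, if_pos rfl]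
    · rw [if_neg hc, decide_eq_false hc]; rfl

/-! ### The dyadic invariant of the refinement -/

/-- `a` is a dyadic of depth `e` in `[0, 1)`: `a = m / 2^e` with `m < 2^e`. [folklore] -/
def IsDyadic (a : ℚ) (e : ℕ) : Prop := ∃ m : ℕ, a = (m : ℚ) / 2 ^ e ∧ m < 2 ^ e

/-- Quadrant centres are dyadics of depth `3`. [folklore] -/
theorem isDyadic_quadrantCenter (c s : Bool) : IsDyadic (quadrantCenter c s) 3 := by
  unfold quadrantCenter IsDyadic
  rcases c with _ | _ <;> rcases s with _ | _
  · exact ⟨5, by norm_num, by norm_num⟩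
  · exact ⟨3, by norm_num, by norm_num⟩
  · exact ⟨7, by norm_num, by norm_num⟩
  · exact ⟨1, by norm_num, by norm_num⟩

/-- `βL` values are dyadics of depth `3`. [folklore] -/
theorem isDyadic_βL (bits : List Bool) (l : ℕ) : IsDyadic (βL Lv B bits l) 3 := by
  unfold βL
  split_ifs
  · exact isDyadic_quadrantCenter _ _
  · exact ⟨0, by norm_num, by norm_num⟩

/-- Halving keeps dyadics, one level deeper. [folklore] -/
theorem isDyadic_halveTowards {a : ℚ} {e : ℕ} (h : IsDyadic a e) (b : ℚ) : IsDyadic (halveTowards a b) (e + 1) := by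
  obtain ⟨m, rfl, hm⟩ := h
  unfold halveTowards
  split_ifs
  · exact ⟨m, by rw [pow_succ, div_div], by rw [pow_succ]; omega⟩
  · refine ⟨m + 2 ^ e, ?_, by rw [pow_succ]; omega⟩
    have h2 : (2 : ℚ) ^ e ≠ 0 := by positivity
    rw [pow_succ]; push_cast; rw [div_add_one h2, div_div]

/-- A depth can be raised. [folklore] -/
theorem IsDyadic.succ {a : ℚ} {e : ℕ} (h : IsDyadic a e) : IsDyadic a (e + 1) := by
  obtain ⟨m, rfl, hm⟩ := h
  refine ⟨2 * m, ?_, by rw [pow_succ]; omega⟩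
  rw [pow_succ', Nat.cast_mul, Nat.cast_two, mul_div_mul_left _ _ (two_ne_zero' ℚ)]

/-- The guarded step keeps dyadics, one level deeper. [folklore] -/
theorem isDyadic_refStep (bits : List Bool) {a : ℚ} {e : ℕ} (h : IsDyadic a e) (i : ℕ) :
    IsDyadic (refStep Lv B bits a i) (e + 1) := by
  unfold refStep
  split_ifs
  · exact isDyadic_halveTowards h _
  · exact h.succ

/-- The fold of guarded steps over any list stays dyadic of depth `3 + length`. [folklore] -/
theorem isDyadic_foldl_refStep (bits : List Bool) : ∀ (l : List ℕ) {a : ℚ} {e : ℕ}, IsDyadic a e →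
    IsDyadic (l.foldl (refStep Lv B bits) a) (e + l.length)
  | [], a, e, h => h
  | i :: l, a, e, h => by
    rw [List.foldl_cons, List.length_cons, show e + (l.length + 1) = (e + 1) + l.length by ring]
    exact isDyadic_foldl_refStep bits l (isDyadic_refStep bits h i)

/-- **Dyadics have short codes**: `|encodeRat a| ≤ 3e + 13` for a dyadic of depth `e` in `[0, 1)`. [folklore] -/
theorem length_encodeRat_le_of_isDyadic {a : ℚ} {e : ℕ} (h : IsDyadic a e) : (encodeRat a).length ≤ 3 * e + 13 := by
  obtain ⟨m, rfl, hm⟩ := h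
  rw [length_encodeRat]
  have h2 : ((2 : ℚ) ^ e) = ((2 ^ e : ℕ) : ℤ) := by push_cast; rfl
  have hq : (m : ℚ) / 2 ^ e = Rat.divInt m ((2 ^ e : ℕ) : ℤ) := by
    rw [Rat.divInt_eq_div]; push_cast; rfl
  have hden : ((m : ℚ) / 2 ^ e).den ≤ 2 ^ e := by
    have hd := Rat.den_dvd (m : ℤ) ((2 ^ e : ℕ) : ℤ)
    rw [← hq] at hd
    have : (((m : ℚ) / 2 ^ e).den : ℤ) ≤ ((2 ^ e : ℕ) : ℤ) := Int.le_of_dvd (by positivity) hd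
    exact_mod_cast this
  have hnum : ((m : ℚ) / 2 ^ e).num.natAbs ≤ m := by
    have hn := Rat.num_dvd (m : ℤ) (b := ((2 ^ e : ℕ) : ℤ)) (by positivity)
    rw [← hq] at hn
    rcases Nat.eq_zero_or_pos m with h0 | hpos
    · subst h0; simp
    · have := Int.le_of_dvd (by exact_mod_cast hpos) hn
      have h1 : (((m : ℚ) / 2 ^ e).num.natAbs : ℤ) ≤ m := by
        rw [← Int.natAbs_of_nonneg (show (0 : ℤ) ≤ ((m : ℚ) / 2 ^ e).num from Rat.num_nonneg.2 (by positivity))] at this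
        exact_mod_cast (show ((((m : ℚ) / 2 ^ e).num.natAbs : ℕ) : ℤ) ≤ m by
          rw [Int.natAbs_of_nonneg (Rat.num_nonneg.2 (by positivity))] at this ⊢; exact this)
      exact_mod_cast h1
  have hs1 : Nat.size ((m : ℚ) / 2 ^ e).num.natAbs ≤ e := by
    refine Nat.size_le.2 (lt_of_le_of_lt hnum hm)
  have hs2 : Nat.size ((m : ℚ) / 2 ^ e).den ≤ e + 1 := by
    refine Nat.size_le.2 ?_
    calc ((m : ℚ) / 2 ^ e).den ≤ 2 ^ e := hden
      _ < 2 ^ (e + 1) := Nat.pow_lt_pow_right (by norm_num) (by omega)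
  omega

/-! ### The character in polynomial time -/

/-- The context code: `(Q, (1^{Lv}, (1^{B}, bits)))`. [folklore] -/
abbrev CE : ℕ × (ℕ × (ℕ × List Bool)) → List Bool := pairE natE (pairE unE (pairE unE strE))

/-- Bit access by a binary position (a copy of `CodeFPStrings.strGetDNat`, kept local to lighten the imports). [cite: AroraBarak2009, §1.3] -/
private theorem strGetDNat'' : CodeFP (pairE strE natE) bitE (fun p => p.1.getD p.2 false) := by
  have h0 : CodeFP (pairE unE strE) bitE (fun p => p.2.getD p.1 false) :=
    ⟨HashBricks.headBitFn ∘ bitAtFn, comp_mem_FP HashBricks.headBitFn_mem_FP bitAtFn_mem_FP, fun p => by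
      rw [pairE_apply, Function.comp_apply, bitAtFn_boolPair, HashBricks.headBitFn_apply, length_unE]
      change [((p.2.drop p.1).take 1).headD false] = [p.2.getD p.1 false]
      rw [List.getD_eq_getElem?_getD, ← List.head?_drop]
      cases p.2.drop p.1 <;> rfl⟩
  exact (h0.comp ((unOfNatMin.comp ((strLength.comp (fst strE natE)).pair (snd strE natE))).pair
    (fst strE natE))).congr fun p => by
      obtain ⟨w, i⟩ := p
      simp only
      by_cases h : i < w.length
      · rw [min_eq_left h.le]
      · push Not at h
        rw [min_eq_right h, List.getD_eq_default _ _ le_rfl, List.getD_eq_default _ _ h]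

/-- Sums of raw lists of binary numerals (a copy of `CodeFPStrings.natSum`). [cite: AroraBarak2009, §1.3] -/
private theorem natSum'' : CodeFP (rawE natE) natE List.sum := by
  have h := intToNat.comp (intSum.comp (map₀ intOfNat))
  refine h.congr fun l => ?_
  show ((l.map fun n : ℕ => (n : ℤ)).sum).toNat = l.sum
  rw [← Nat.cast_list_sum, Int.toNat_natCast]

/-- Unary multiplication by a constant (a copy of `CodeFPStrings.unMulConst`). [folklore] -/
private theorem unMulConst'' : ∀ c : ℕ, CodeFP unE unE (fun n => c * n)
  | 0 => (const unE 0).congr fun n => by simp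
  | c + 1 => (unAdd.comp ((unMulConst'' c).pair (CodeFP.id unE))).congr fun n => by simp [add_mul]

/-- `Bool.toNat` on codes. [folklore] -/
private theorem toNat'' : CodeFP bitE natE Bool.toNat := by
  have h : CodeFP bitE natE (fun b => if b then 1 else 0) := (CodeFP.id bitE).ite (const _ 1) (const _ 0)
  exact h.congr fun b => by cases b <;> rfl

/-- **Block counts are polynomial time**: `((ctx, l), σ) ↦ cntL B bits l σ`. [cite: Kitaev1995, §3] -/
theorem codeFP_cntL : CodeFP (pairE (pairE CE natE) bitE) natE (fun t => cntL t.1.1.2.2.1 t.1.1.2.2.2 t.1.2 t.2) := by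
  -- items `(((ctx, l), σ), i)`
  have hB : CodeFP (pairE (pairE (pairE CE natE) bitE) natE) natE (fun r => r.1.1.1.2.2.1) :=
    (natOfUn.comp (fst _ _).fst'.fst'.snd'.snd'.fst' :)
  have hbits : CodeFP (pairE (pairE (pairE CE natE) bitE) natE) strE (fun r => r.1.1.1.2.2.2) := (fst _ _).fst'.fst'.snd'.snd'.snd'
  have hl : CodeFP (pairE (pairE (pairE CE natE) bitE) natE) natE (fun r => r.1.1.2) := (fst _ _).fst'.snd'
  have hσ : CodeFP (pairE (pairE (pairE CE natE) bitE) natE) natE (fun r => r.1.2.toNat) := (toNat''.comp (fst _ _).snd' :)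
  have hi : CodeFP (pairE (pairE (pairE CE natE) bitE) natE) natE (fun r => r.2) := snd _ _
  have hpos' := (natAdd.comp ((natAdd.comp (hi.pair (natMul.comp (hB.pair hσ)))).pair
      (natMul.comp ((natMul.comp ((const _ 2).pair hB)).pair hl))) :)
  have hpos : CodeFP (pairE (pairE (pairE CE natE) bitE) natE) natE (fun r => posOf r.1.1.1.2.2.1 r.1.1.2 r.1.2 r.2) :=
    hpos'.congr fun r => by simp [posOf]
  have hitem : CodeFP (pairE (pairE (pairE CE natE) bitE) natE) natE
      (fun r => (r.1.1.1.2.2.2.getD (posOf r.1.1.1.2.2.1 r.1.1.2 r.1.2 r.2) false).toNat) :=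
    (toNat''.comp (strGetDNat''.comp (hbits.pair hpos)) :)
  have hrange : CodeFP (pairE (pairE CE natE) bitE) (rawE natE) (fun t => List.range t.1.1.2.2.1) :=
    (urange.comp (fst _ _).fst'.snd'.snd'.fst' :)
  have hfin := (natSum''.comp ((map hitem).comp ((CodeFP.id _).pair hrange)) :)
  exact hfin.congr fun t => rfl

/-- **Quadrant centres are polynomial time**: `(ctx, l) ↦ levelL B bits l`. [cite: Kitaev1995, §3 Lemma 10] -/
theorem codeFP_levelL : CodeFP (pairE CE natE) encodeRat (fun t => levelL t.1.2.2.1 t.1.2.2.2 t.2) := by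
  have hB : CodeFP (pairE CE natE) natE (fun t => t.1.2.2.1) := (natOfUn.comp (fst _ _).snd'.snd'.fst' :)
  have hcF : CodeFP (pairE CE natE) natE (fun t => cntL t.1.2.2.1 t.1.2.2.2 t.2 false) :=
    (codeFP_cntL.comp ((CodeFP.id _).pair (const _ false)) :)
  have hcT : CodeFP (pairE CE natE) natE (fun t => cntL t.1.2.2.1 t.1.2.2.2 t.2 true) :=
    (codeFP_cntL.comp ((CodeFP.id _).pair (const _ true)) :)
  have hbF : CodeFP (pairE CE natE) bitE (fun t => decide (2 * cntL t.1.2.2.1 t.1.2.2.2 t.2 false ≤ t.1.2.2.1)) :=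
    (natLe.comp ((natMul.comp ((const _ 2).pair hcF)).pair hB) :)
  have hbT : CodeFP (pairE CE natE) bitE (fun t => decide (2 * cntL t.1.2.2.1 t.1.2.2.2 t.2 true ≤ t.1.2.2.1)) :=
    (natLe.comp ((natMul.comp ((const _ 2).pair hcT)).pair hB) :)
  have hT : CodeFP (pairE CE natE) encodeRat (fun t => if decide (2 * cntL t.1.2.2.1 t.1.2.2.2 t.2 true ≤ t.1.2.2.1) then (1 / 8 : ℚ) else 7 / 8) :=
    (hbT.ite (const _ (1 / 8 : ℚ)) (const _ (7 / 8 : ℚ)) :)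
  have hF : CodeFP (pairE CE natE) encodeRat (fun t => if decide (2 * cntL t.1.2.2.1 t.1.2.2.2 t.2 true ≤ t.1.2.2.1) then (3 / 8 : ℚ) else 5 / 8) :=
    (hbT.ite (const _ (3 / 8 : ℚ)) (const _ (5 / 8 : ℚ)) :)
  have h : CodeFP (pairE CE natE) encodeRat (fun t => if decide (2 * cntL t.1.2.2.1 t.1.2.2.2 t.2 false ≤ t.1.2.2.1) then
      (if decide (2 * cntL t.1.2.2.1 t.1.2.2.2 t.2 true ≤ t.1.2.2.1) then (1 / 8 : ℚ) else 7 / 8) else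
      (if decide (2 * cntL t.1.2.2.1 t.1.2.2.2 t.2 true ≤ t.1.2.2.1) then (3 / 8 : ℚ) else 5 / 8)) := hbF.ite hT hF
  exact h.congr fun t => by simp only [levelL, quadrantCenter]

/-- **The level estimates are polynomial time**: `(ctx, l) ↦ βL Lv B bits l`. [folklore] -/
theorem codeFP_βL : CodeFP (pairE CE natE) encodeRat (fun t => βL t.1.2.1 t.1.2.2.1 t.1.2.2.2 t.2) := by
  have hLv : CodeFP (pairE CE natE) natE (fun t => t.1.2.1) := (natOfUn.comp (fst _ _).snd'.fst' :)
  have hlt : CodeFP (pairE CE natE) bitE (fun t => decide (t.2 < t.1.2.1)) := (natLt.comp ((snd _ _).pair hLv) :)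
  have h : CodeFP (pairE CE natE) encodeRat (fun t => if decide (t.2 < t.1.2.1) then levelL t.1.2.2.1 t.1.2.2.2 t.2 else 0) :=
    (hlt.ite codeFP_levelL (const _ (0 : ℚ)) :)
  exact h.congr fun t => by
    simp only [βL]
    by_cases hc : t.2 < t.1.2.1
    · rw [decide_eq_true hc, if_pos rfl, if_pos hc]
    · rw [decide_eq_false hc, if_neg hc]; rfl

/-- **The refinement is polynomial time** (a fold of the guarded halving step; the accumulator is a
dyadic of depth `≤ 3 +` number of steps, `length_encodeRat_le_of_isDyadic`). [cite: Kitaev1995, §3 Lemma 10 (l halvings)] -/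
theorem codeFP_refined : CodeFP CE encodeRat (fun c => (List.range c.2.1).foldl (refStep c.2.1 c.2.2.1 c.2.2.2) (βL c.2.1 c.2.2.1 c.2.2.2 (c.2.1 - 1))) := by
  have hLv : CodeFP (pairE CE (pairE natE encodeRat)) natE (fun t => t.1.2.1) := (natOfUn.comp (fst _ _).snd'.fst' :)
  have hi : CodeFP (pairE CE (pairE natE encodeRat)) natE (fun t => t.2.1) := (snd _ _).fst'
  have ha : CodeFP (pairE CE (pairE natE encodeRat)) encodeRat (fun t => t.2.2) := (snd _ _).snd'
  have hguard : CodeFP (pairE CE (pairE natE encodeRat)) bitE (fun t => decide (t.2.1 + 1 < t.1.2.1)) :=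
    (natLt.comp ((natAdd.comp (hi.pair (const _ 1))).pair hLv) :)
  have hidx : CodeFP (pairE CE (pairE natE encodeRat)) natE (fun t => t.1.2.1 - 1 - (t.2.1 + 1)) :=
    (natSub.comp ((natSub.comp (hLv.pair (const _ 1))).pair (natAdd.comp (hi.pair (const _ 1)))) :)
  have hβ : CodeFP (pairE CE (pairE natE encodeRat)) encodeRat (fun t => βL t.1.2.1 t.1.2.2.1 t.1.2.2.2 (t.1.2.1 - 1 - (t.2.1 + 1))) :=
    (codeFP_βL.comp ((fst _ _).pair hidx) :)
  have hstep0 : CodeFP (pairE CE (pairE natE encodeRat)) encodeRat (fun t => if decide (t.2.1 + 1 < t.1.2.1) then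
      halveTowards t.2.2 (βL t.1.2.1 t.1.2.2.1 t.1.2.2.2 (t.1.2.1 - 1 - (t.2.1 + 1))) else t.2.2) :=
    (hguard.ite (halveTowardsC.comp (ha.pair hβ)) ha :)
  have hstep : CodeFP (pairE CE (pairE natE encodeRat)) encodeRat (fun t => refStep t.1.2.1 t.1.2.2.1 t.1.2.2.2 t.2.2 t.2.1) :=
    hstep0.congr fun t => by
      simp only [refStep]
      by_cases hc : t.2.1 + 1 < t.1.2.1
      · rw [decide_eq_true hc, if_pos rfl, if_pos hc]
      · rw [decide_eq_false hc, if_neg hc]; rfl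
  have hinit : CodeFP CE encodeRat (fun c => βL c.2.1 c.2.2.1 c.2.2.2 (c.2.1 - 1)) :=
    (codeFP_βL.comp ((CodeFP.id CE).pair (natSub.comp ((natOfUn.comp (snd _ _).fst').pair (const _ 1)))) :)
  have h := foldl (σ := ℕ × (ℕ × (ℕ × List Bool))) (α := ℕ) (β := ℚ) (eσ := CE) (eα := natE) (eβ := encodeRat)
    (step := fun c i a => refStep c.2.1 c.2.2.1 c.2.2.2 a i) (init := fun c => βL c.2.1 c.2.2.1 c.2.2.2 (c.2.1 - 1))
    ((hstep.comp ((fst _ _).pair ((snd _ _).fst'.pair (snd _ _).snd'))) :) hinit (3 * X + 22) (fun c l₁ l₂ => by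
      have hd := isDyadic_foldl_refStep (Lv := c.2.1) (B := c.2.2.1) c.2.2.2 l₁ (isDyadic_βL (Lv := c.2.1) (B := c.2.2.1) c.2.2.2 (c.2.1 - 1))
      refine (length_encodeRat_le_of_isDyadic hd).trans ?_
      simp only [eval_add, eval_mul, eval_X, eval_ofNat]
      have h1 : l₁.length ≤ (rawE natE (l₁ ++ l₂)).length := le_trans (by simp) (length_le_length_rawE natE (l₁ ++ l₂))
      have h2 : (pairE CE (rawE natE) (c, l₁ ++ l₂)).length = 2 * (CE c).length + 2 + (rawE natE (l₁ ++ l₂)).length := by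
        rw [pairE_apply, length_boolPair]
      omega)
  have hfin := (h.comp ((CodeFP.id CE).pair (urange.comp (snd _ _).fst')) :)
  exact hfin.congr fun c => rfl

/-- **The character read off a unit is polynomial time**: `(Q, 1^{Lv}, 1^{B}, bits) ↦ cEst Q (γL Lv B bits)`.
[cite: Kitaev1995, §3 Thm 1 (the reconstruction is polynomial time)] -/
theorem codeFP_cEstL : CodeFP CE natE (fun c => cEstL c.1 c.2.1 c.2.2.1 c.2.2.2) := by
  have hQ : CodeFP CE natE (fun c => c.1) := fst _ _
  have hr : CodeFP CE intE (fun c => round ((List.range c.2.1).foldl (refStep c.2.1 c.2.2.1 c.2.2.2) (βL c.2.1 c.2.2.1 c.2.2.2 (c.2.1 - 1)) * (c.1 : ℚ))) :=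
    (ratRound.comp (ratMul.comp (codeFP_refined.pair (ratOfNat'.comp hQ))) :)
  have hQz : CodeFP CE intE (fun c => (c.1 : ℤ)) := (intOfNat.comp hQ :)
  have hmod : CodeFP CE intE (fun c => round ((List.range c.2.1).foldl (refStep c.2.1 c.2.2.1 c.2.2.2) (βL c.2.1 c.2.2.1 c.2.2.2 (c.2.1 - 1)) * (c.1 : ℚ)) % (c.1 : ℤ)) :=
    by
      have hfin := (intSub.comp (hr.pair (intMul.comp (hQz.pair (intEDiv.comp (hr.pair hQz))))) :)
      exact hfin.congr fun c => by rw [Int.emod_def]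
  have hfin := (intToNat.comp hmod :)
  exact hfin.congr fun c => by rw [cEstL_eq]

end PeriodFinding

end Literature.Computability.Cryptography

end
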